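import Summits.AtomisticToContinuum.HydrodynamicLimit.Theorems.OneFlightGossipEngineEquilibriumClampedCollisionalWindowLDDefs

/-!
# Pathwise record kinematics for the line `coarse-coin-entropy-chain` (crux `EquilibriumClampedCollisionalWindowLD`)

Helper lemmas (`--supports stmt-AtomisticToContinuum-13733`) for the registered stub `stub_adaptedClampKinematics`
(file `…StubAdaptedClampKinematics.lean`) and its siblings, over the vocabulary `…EquilibriumClampedCollisionalWindowLDDefs`
(namespace `…Theorems.ClampedTransferCoin`): a Lipschitz constant of a smooth `φ : 𝕋³ → ℝ` for the minimal-image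
separation (`exists_lipschitz`); the record algebra of an elastic reflection (`‖v⁺ - v⁻‖ ≤ ‖g‖`,
`‖v⁺‖² - ‖v⁻‖² = ⟪v⁻ + w⁻, v⁺ - v⁻⟫`), whence `|payload| ≤ M · impulse` and `|payload| ≤ L · rangeBase`; the running-clamp
lemma and the clamp-swap indicator algebra; the enumeration of a locally finite set of times (`nthTimeAfter_mem`,
`coinTime_mem`: the `n`-th coin, `n < coinCount`, is a collision time in `(0, w]`); along a good orbit: monotone running
activities, `{0,1}`-valued clamps with `ω ≤ ω̃(t) ≤ ω̃⁻(t)`, `le_runAct` / `impulse_le_of_flagA` (a record is counted in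
the closed running activity of its first particle), and the TWIN-RECORD facts valid at EVERY diameter on the torus (no
`ε < 1/2` regularity): `swap_mem_contactPairs_torus`, `card_contactPairs_le_two`, `impulse_twin` (both records of a
collision read the same left limit, `IsHardSphereTrajectory.ofConfig_preVel_eq_leftLim`; pair momentum/energy conserved).
-/

noncomputable section

open MeasureTheory ProbabilityTheory Set Filter
open scoped ENNReal BigOperators
open Literature.Analysis.FluidPDE Literature.MathematicalPhysics.KineticTheory
open Literature.Analysis.FunctionSpaces (Torus.partialDeriv Torus.IsSmooth)

namespace Summit.AtomisticToContinuum.HydrodynamicLimit.Theorems.ClampedTransferCoin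

namespace AdaptedClampKinematics

open HardSphereCollisionRecord

section Lipschitz

open Literature.Analysis.FunctionSpaces (Torus.lift Torus.proj Torus.lift_apply Torus.proj_add
  Torus.fderiv_lift Torus.continuous_lift_iff Torus.proj_surjective)

/-- A smooth function on `𝕋³` is Lipschitz for the minimal-image separation vector: `|φ x - φ y| ≤ L ‖sepVec x y‖`
(mean value inequality on `ℝ³` between a lift of `y` and its translate by `sepVec x y`, which lifts `x`). -/
theorem exists_lipschitz (φ : T3 → ℝ) (hφ : Torus.IsSmooth φ) :
    ∃ L : ℝ, 0 < L ∧ ∀ x y : T3, |φ x - φ y| ≤ L * ‖(Torus.geometry (Fin 3)).sepVec x y‖ := by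
  have hC1 : ContDiff ℝ 1 (Torus.lift φ) := hφ.isContDiff (by simp)
  have hd : Differentiable ℝ (Torus.lift φ) := hC1.differentiable one_ne_zero
  have hcont : Continuous (Literature.Analysis.FunctionSpaces.Torus.fderiv φ) := by
    refine Torus.continuous_lift_iff.1 ?_
    have : Torus.lift (Literature.Analysis.FunctionSpaces.Torus.fderiv φ) =
        fun y => fderiv ℝ (Torus.lift φ) y := funext fun y => (Torus.fderiv_lift φ y).symm
    rw [this]
    exact hC1.continuous_fderiv one_ne_zero
  obtain ⟨C, hC⟩ := hcont.bounded_above_of_compact_support (HasCompactSupport.of_compactSpace _)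
  refine ⟨max C 1, lt_max_of_lt_right one_pos, fun x y => ?_⟩
  obtain ⟨y', hy'⟩ := Torus.proj_surjective y
  have hx : Torus.proj (y' + (Torus.geometry (Fin 3)).sepVec x y) = x := by
    rw [Torus.proj_add, hy', Torus.geometry_sepVec, Torus.proj_reprSym, add_sub_cancel]
  have hmv := Convex.norm_image_sub_le_of_norm_fderiv_le (f := Torus.lift φ) (s := Set.univ) (x := y')
    (y := y' + (Torus.geometry (Fin 3)).sepVec x y) (C := max C 1) (fun z _ => hd z) (fun z _ => ?_)
    convex_univ (mem_univ _) (mem_univ _)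
  · rw [Torus.lift_apply, Torus.lift_apply, hx, hy', add_sub_cancel_left, Real.norm_eq_abs] at hmv
    exact hmv
  · rw [Torus.fderiv_lift]
    exact (hC _).trans (le_max_left _ _)

end Lipschitz

/-! ### Record algebra: the velocity and energy jumps of an elastic reflection -/

section Reflect

variable {E : Type*} [NormedAddCommGroup E] [InnerProductSpace ℝ E]

/-- The velocity jump of the first particle in an elastic reflection is radial, `v⁺ - v⁻ = -(⟪g, n⟫/‖n‖²) n` with
`g = v⁻ - w⁻`, hence (Cauchy–Schwarz) `‖v⁺ - v⁻‖ ≤ ‖g‖`. -/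
theorem norm_reflectVel_fst_sub_le (n : E) (p : E × E) : ‖(reflectVel n p).1 - p.1‖ ≤ ‖p.1 - p.2‖ := by
  have h1 : (reflectVel n p).1 - p.1 = -((inner ℝ (p.1 - p.2) n / ‖n‖ ^ 2) • n) := by simp [reflectVel]
  rw [h1, norm_neg]
  by_cases hn : n = 0
  · simp [hn]
  have hn' : 0 < ‖n‖ := norm_pos_iff.2 hn
  rw [norm_smul, norm_div, norm_pow, norm_norm, Real.norm_eq_abs, div_mul_eq_mul_div,
    div_le_iff₀ (by positivity), pow_two, ← mul_assoc]
  exact mul_le_mul_of_nonneg_right (abs_real_inner_le_norm _ n) hn'.le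

/-- Energy-jump identity of an elastic reflection: `‖v⁺‖² - ‖v⁻‖² = ⟪v⁻ + w⁻, v⁺ - v⁻⟫`. -/
theorem norm_sq_reflectVel_fst_sub (n : E) (p : E × E) :
    ‖(reflectVel n p).1‖ ^ 2 - ‖p.1‖ ^ 2 = inner ℝ (p.1 + p.2) ((reflectVel n p).1 - p.1) := by
  by_cases hn : n = 0
  · simp [hn]
  have hn2 : ‖n‖ ^ 2 ≠ 0 := pow_ne_zero 2 (norm_ne_zero_iff.2 hn)
  set β := inner ℝ (p.1 - p.2) n / ‖n‖ ^ 2 with hβdef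
  have hβ : β * ‖n‖ ^ 2 = inner ℝ p.1 n - inner ℝ p.2 n := by
    rw [hβdef, div_mul_cancel₀ _ hn2, inner_sub_left]
  have h1 : (reflectVel n p).1 = p.1 - β • n := by simp [reflectVel, hβdef]
  rw [h1, sub_sub_cancel_left, inner_neg_right, real_inner_smul_right, norm_sub_sq_real,
    real_inner_smul_right, norm_smul, mul_pow, Real.norm_eq_abs, sq_abs, inner_add_left]
  linear_combination β * hβ

end Reflect

section Records

variable {N : ℕ}

/-- The transfer impulse is nonnegative. -/
theorem impulse_nonneg (c : Rec N) : 0 ≤ impulse c := by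
  unfold impulse; positivity

/-- A guarded transfer impulse is nonnegative. -/
theorem ite_impulse_nonneg (P : Prop) [Decidable P] (c : Rec N) : 0 ≤ (if P then impulse c else 0) := by
  split_ifs
  exacts [impulse_nonneg c, le_rfl]

/-- `|payload| ≤ M · impulse` as soon as `|φ(x_fst) - φ(x_snd)| ≤ M`. -/
theorem abs_payload_le_impulse (φ : T3 → ℝ) {M : ℝ} (hM0 : 0 ≤ M) (c : Rec N)
    (hM : |φ c.fstPos - φ c.sndPos| ≤ M) (r : Option (Fin 3)) : |payload φ r c| ≤ M * impulse c := by
  have hI1 : ‖c.postVel.1 - c.preVel.1‖ ≤ impulse c := by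
    unfold impulse; exact le_add_of_nonneg_right (by positivity)
  have hI2 : |‖c.postVel.1‖ ^ 2 - ‖c.preVel.1‖ ^ 2| / 2 ≤ impulse c := by
    unfold impulse; exact le_add_of_nonneg_left (norm_nonneg _)
  cases r with
  | none =>
    simp only [payload]
    rw [abs_mul, abs_div, abs_two]
    exact mul_le_mul hM hI2 (by positivity) hM0
  | some k =>
    simp only [payload]
    rw [abs_mul]
    have hk : |c.postVel.1 k - c.preVel.1 k| ≤ ‖c.postVel.1 - c.preVel.1‖ := by
      simpa using PiLp.norm_apply_le (c.postVel.1 - c.preVel.1) k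
    exact mul_le_mul hM (hk.trans hI1) (abs_nonneg _) hM0

/-- `|payload| ≤ L · rangeBase` as soon as `|φ(x_fst) - φ(x_snd)| ≤ L ε_N`, WHATEVER the impact parameter: the
post-collisional velocities of an `ofConfig` record are the reflection of the pre-collisional ones. -/
theorem abs_payload_le_rangeBase (φ : T3 → ℝ) {L : ℝ} (hL : 0 ≤ L) (σ : ℝ) (hε : 0 ≤ hsDiameter σ N)
    (G : Geometry (Fin 3) T3) (z : Phase N) (t : ℝ) (i j : Fin (N + 1))
    (hM : |φ (z i).1 - φ (z j).1| ≤ L * hsDiameter σ N) (r : Option (Fin 3)) :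
    |payload φ r (ofConfig G (hsDiameter σ N) z t i j)| ≤
      L * rangeBase σ N r (ofConfig G (hsDiameter σ N) z t i j) := by
  set c := ofConfig G (hsDiameter σ N) z t i j with hc
  have hpost : c.postVel = reflectVel (G.sepVec (z i).1 (z j).1) c.preVel := by
    simp only [hc, ofConfig_preVel, ofConfig_postVel, reflectVel_reflectVel]
  have hJ : ‖c.postVel.1 - c.preVel.1‖ ≤ ‖c.preVel.1 - c.preVel.2‖ := by
    rw [hpost]; exact norm_reflectVel_fst_sub_le _ _
  have hE : |‖c.postVel.1‖ ^ 2 - ‖c.preVel.1‖ ^ 2| ≤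
      ‖c.preVel.1 + c.preVel.2‖ * ‖c.postVel.1 - c.preVel.1‖ := by
    rw [hpost, norm_sq_reflectVel_fst_sub]; exact abs_real_inner_le_norm _ _
  have hM' : |φ c.fstPos - φ c.sndPos| ≤ L * hsDiameter σ N := by
    rw [hc, ofConfig_fstPos, ofConfig_sndPos]; exact hM
  cases r with
  | none =>
    simp only [payload, rangeBase]
    rw [abs_mul, abs_div, abs_two]
    calc |φ c.fstPos - φ c.sndPos| * (_ / 2)
        ≤ L * hsDiameter σ N * (‖c.preVel.1 + c.preVel.2‖ * ‖c.preVel.1 - c.preVel.2‖ / 2) :=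
          mul_le_mul hM' (div_le_div_of_nonneg_right
            (hE.trans (mul_le_mul_of_nonneg_left hJ (norm_nonneg _))) zero_le_two) (by positivity) (by positivity)
      _ = _ := by ring
  | some k =>
    simp only [payload, rangeBase]
    rw [abs_mul]
    have hk : |c.postVel.1 k - c.preVel.1 k| ≤ ‖c.postVel.1 - c.preVel.1‖ := by
      simpa using PiLp.norm_apply_le (c.postVel.1 - c.preVel.1) k
    calc |φ c.fstPos - φ c.sndPos| * _ ≤ L * hsDiameter σ N * ‖c.preVel.1 - c.preVel.2‖ :=
          mul_le_mul hM' (hk.trans hJ) (abs_nonneg _) (by positivity)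
      _ = _ := by ring

/-- The kinematic range is nonnegative. -/
theorem rangeBase_nonneg {σ : ℝ} (hε : 0 ≤ hsDiameter σ N) (r : Option (Fin 3)) (c : Rec N) :
    0 ≤ rangeBase σ N r c := by
  cases r <;> simp only [rangeBase] <;> positivity

end Records

/-! ### Indicator algebra, the running clamp, the enumeration of a locally finite set of times -/

/-- A `{0,1}`-valued real lies in `[0, 1]`. -/
theorem mem_Icc_of_eq_one_or {x : ℝ} (h : x = 1 ∨ x = 0) : 0 ≤ x ∧ x ≤ 1 := by
  rcases h with rfl | rfl <;> norm_num

/-- The clamp-swap indicator algebra: for `{0,1}`-valued `a ≤ A`, `b ≤ B`, `|ab - AB| ≤ (1 - a)A + (1 - b)B`. -/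
theorem abs_mul_sub_mul_le {a b A B : ℝ} (ha : a = 1 ∨ a = 0) (hb : b = 1 ∨ b = 0) (hA : A = 1 ∨ A = 0)
    (hB : B = 1 ∨ B = 0) (haA : a ≤ A) (hbB : b ≤ B) :
    |a * b - A * B| ≤ (1 - a) * A + (1 - b) * B := by
  rcases ha with rfl | rfl <;> rcases hb with rfl | rfl <;> rcases hA with rfl | rfl <;>
    rcases hB with rfl | rfl <;> revert haA hbB <;> norm_num

/-- **Running clamp.** Nonnegative amounts `a t`, retained (`χ t = 1`) only while their CLOSED running sum is
`≤ V'`, have retained total `≤ V'`: the last retained time certifies it. -/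
theorem sum_indicator_running_le (T : Finset ℝ) (a χ : ℝ → ℝ) {V' : ℝ} (ha : ∀ t ∈ T, 0 ≤ a t)
    (hχ : ∀ t ∈ T, χ t = 1 ∨ χ t = 0) (hχV : ∀ t ∈ T, χ t = 1 → ∑ s ∈ T.filter (· ≤ t), a s ≤ V')
    (hV' : 0 ≤ V') : ∑ t ∈ T, χ t * a t ≤ V' := by
  rcases (T.filter fun t => χ t = 1).eq_empty_or_nonempty with hE | hne
  · refine (Finset.sum_eq_zero fun t ht => ?_).trans_le hV'
    rcases hχ t ht with h | h
    · have hmem : t ∈ T.filter fun t => χ t = 1 := Finset.mem_filter.2 ⟨ht, h⟩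
      rw [hE] at hmem
      simp at hmem
    · rw [h, zero_mul]
  · obtain ⟨htT, h1⟩ := Finset.mem_filter.1 ((T.filter fun t => χ t = 1).max'_mem hne)
    calc ∑ t ∈ T, χ t * a t
        ≤ ∑ t ∈ T, (if t ≤ (T.filter fun t => χ t = 1).max' hne then a t else 0) :=
          Finset.sum_le_sum fun t ht => by
            rcases hχ t ht with h | h
            · rw [h, one_mul, if_pos ((T.filter fun t => χ t = 1).le_max' t (Finset.mem_filter.2 ⟨ht, h⟩))]
            · rw [h, zero_mul]
              split_ifs
              exacts [ha t ht, le_rfl]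
      _ = ∑ s ∈ T.filter (· ≤ (T.filter fun t => χ t = 1).max' hne), a s := (Finset.sum_filter _ _).symm
      _ ≤ V' := hχV _ htT h1

/-- One step of the enumeration of a locally finite set of times: past `x ≥ 0`, with at most
`m < #(S ∩ (0, w])` times in `(0, x]`, the next time after `x` lies in `S ∩ (0, w]` and at most `m + 1` times lie
in `(0, it]`. -/
theorem nextTimeAfter_step {S : Set ℝ} (hS : ∀ a b, (S ∩ Icc a b).Finite) {w x : ℝ} (hx : 0 ≤ x) {m : ℕ}
    (hm : (S ∩ Ioc 0 x).ncard ≤ m) (hK : m < (S ∩ Ioc 0 w).ncard) :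
    nextTimeAfter S x ∈ S ∩ Ioc 0 w ∧ (S ∩ Ioc 0 (nextTimeAfter S x)).ncard ≤ m + 1 := by
  have hA : (S ∩ Ioc 0 x).Finite := (hS 0 x).subset (inter_subset_inter_right _ Ioc_subset_Icc_self)
  obtain ⟨s, hsF, hsA⟩ : ∃ s ∈ S ∩ Ioc 0 w, s ∉ S ∩ Ioc 0 x := by
    by_contra h
    push Not at h
    exact absurd (Set.ncard_le_ncard h hA) (not_le.2 (hm.trans_lt hK))
  have hxs : x < s := by
    by_contra h'
    exact hsA ⟨hsF.1, hsF.2.1, not_lt.1 h'⟩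
  have hL := isLeast_nextTimeAfter (S := S) (x := x)
    (fun b => (hS x b).subset (inter_subset_inter_right _ Ioc_subset_Icc_self)) ⟨s, hsF.1, hxs⟩
  refine ⟨⟨hL.1.1, hx.trans_lt hL.1.2, (hL.2 ⟨hsF.1, hxs⟩).trans hsF.2.2⟩, ?_⟩
  have hsub : S ∩ Ioc 0 (nextTimeAfter S x) ⊆ insert (nextTimeAfter S x) (S ∩ Ioc 0 x) := by
    rintro u ⟨huS, hu0, hut⟩
    rcases le_or_gt u x with hux | hxu
    · exact Or.inr ⟨huS, hu0, hux⟩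
    · exact Or.inl (le_antisymm hut (hL.2 ⟨huS, hxu⟩))
  calc (S ∩ Ioc 0 (nextTimeAfter S x)).ncard ≤ (insert (nextTimeAfter S x) (S ∩ Ioc 0 x)).ncard :=
        Set.ncard_le_ncard hsub (hA.insert _)
    _ ≤ (S ∩ Ioc 0 x).ncard + 1 := Set.ncard_insert_le _ _
    _ ≤ m + 1 := by omega

/-- **Enumeration of a locally finite set of times.** For `n < #(S ∩ (0, w])` the `n`-th time after `0`
(`nthTimeAfter S 0 n`) lies in `S ∩ (0, w]`, and at most `n + 1` times lie in `(0, it]`. -/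
theorem nthTimeAfter_mem {S : Set ℝ} (hS : ∀ a b, (S ∩ Icc a b).Finite) {w : ℝ} :
    ∀ n, n < (S ∩ Ioc 0 w).ncard →
      nthTimeAfter S 0 n ∈ S ∩ Ioc 0 w ∧ (S ∩ Ioc 0 (nthTimeAfter S 0 n)).ncard ≤ n + 1
  | 0, h0 => nextTimeAfter_step hS le_rfl (by simp) h0
  | n + 1, hn => by
    obtain ⟨hmem, hcard⟩ := nthTimeAfter_mem hS n (n.lt_succ_self.trans hn)
    rw [nthTimeAfter_succ]
    exact nextTimeAfter_step hS hmem.2.1.le hcard hn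

section Orbit

variable {σ τ V : ℝ} {N : ℕ} (Φ : Flow σ N) {z : Phase N}

/-- For a nonnegative summand the collision pair sum of a curve is monotone in the window. -/
theorem collisionPairSum_mono_set {G : Geometry (Fin 3) T3} {γ : ℝ → Phase N} {ε : ℝ} {S T : Set ℝ}
    (hT : (collisionTimes G ε γ ∩ T).Finite) (hST : S ⊆ T) {g : ℝ → Fin (N + 1) → Fin (N + 1) → ℝ}
    (hg : ∀ t i j, 0 ≤ g t i j) : collisionPairSum G ε γ S g ≤ collisionPairSum G ε γ T g := by
  have hS : (collisionTimes G ε γ ∩ S).Finite := hT.subset (inter_subset_inter_right _ hST)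
  rw [collisionPairSum_eq_finset_sum hS, collisionPairSum_eq_finset_sum hT]
  refine Finset.sum_le_sum_of_subset_of_nonneg (fun t ht => ?_) fun t _ _ =>
    Finset.sum_nonneg fun p _ => hg t p.1 p.2
  rw [Set.Finite.mem_toFinset] at ht ⊢
  exact ⟨ht.1, hST ht.2⟩

/-- On a good orbit the running activities are monotone in the window: `preAct t ≤ runAct t ≤ runAct t'` for
`t ≤ t'`. -/
theorem preAct_le_runAct_le (hz : z ∈ Φ.good) (hστ : 0 ≤ σ / τ) {t t' : ℝ} (htt' : t ≤ t') (i : Fin (N + 1)) :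
    preAct σ τ Φ t i z ≤ runAct σ τ Φ t i z ∧ runAct σ τ Φ t i z ≤ runAct σ τ Φ t' i z := by
  unfold preAct runAct
  refine ⟨mul_le_mul_of_nonneg_left ?_ hστ, mul_le_mul_of_nonneg_left ?_ hστ⟩ <;>
    simp only [HardSphereFlow.collisionSum_eq, collisionSum_eq_collisionPairSum]
  · exact collisionPairSum_mono_set (Φ.finite_collisionTimes_inter hz Ioc_subset_Icc_self)
      Ioo_subset_Ioc_self fun _ _ _ => ite_impulse_nonneg _ _
  · exact collisionPairSum_mono_set (Φ.finite_collisionTimes_inter hz Ioc_subset_Icc_self)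
      (Ioc_subset_Ioc_right htt') fun _ _ _ => ite_impulse_nonneg _ _

/-- The adapted clamp is `{0,1}`-valued. -/
theorem flagA_eq_one_or (t : ℝ) (i : Fin (N + 1)) : flagA σ τ V Φ t i z = 1 ∨ flagA σ τ V Φ t i z = 0 := by
  unfold flagA; split_ifs <;> simp

/-- The window-global clamp is `{0,1}`-valued. -/
theorem flagG_eq_one_or (i : Fin (N + 1)) : flagG σ τ V Φ i z = 1 ∨ flagG σ τ V Φ i z = 0 := by
  unfold flagG; split_ifs <;> simp

/-- The predictable clamp is `{0,1}`-valued. -/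
theorem flagP_eq_one_or (t : ℝ) (i : Fin (N + 1)) : flagP σ τ V Φ t i z = 1 ∨ flagP σ τ V Φ t i z = 0 := by
  unfold flagP; split_ifs <;> simp

/-- The window-global clamp is below the adapted clamp at every time of the window. -/
theorem flagG_le_flagA (hz : z ∈ Φ.good) (hστ : 0 ≤ σ / τ) {t : ℝ} (ht : t ≤ window τ N)
    (i : Fin (N + 1)) : flagG σ τ V Φ i z ≤ flagA σ τ V Φ t i z := by
  have hmono := (preAct_le_runAct_le Φ hz hστ ht i).2
  unfold flagG flagA
  split_ifs <;> first | exact le_rfl | exact zero_le_one | linarith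

/-- The adapted clamp is below the predictable clamp. -/
theorem flagA_le_flagP (hz : z ∈ Φ.good) (hστ : 0 ≤ σ / τ) (t : ℝ) (i : Fin (N + 1)) :
    flagA σ τ V Φ t i z ≤ flagP σ τ V Φ t i z := by
  have hmono := (preAct_le_runAct_le Φ hz hστ le_rfl i (t := t)).1
  unfold flagA flagP
  split_ifs <;> first | exact le_rfl | exact zero_le_one | linarith

/-- A record of the orbit at a collision time `t > 0` is counted in the running activity of its first particle
on the closed interval `(0, t]`. -/
theorem le_runAct (hz : z ∈ Φ.good) (hστ : 0 ≤ σ / τ) {t : ℝ} (ht : 0 < t) {p : Fin (N + 1) × Fin (N + 1)}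
    (hp : p ∈ contactPairs (Torus.geometry (Fin 3)) (hsDiameter σ N) (Φ.flow t z)) :
    σ / τ * impulse (ofConfig (Torus.geometry (Fin 3)) (hsDiameter σ N) (Φ.flow t z) t p.1 p.2) ≤
      runAct σ τ Φ t p.1 z := by
  unfold runAct
  refine mul_le_mul_of_nonneg_left ?_ hστ
  have hfin : (collisionTimes (Torus.geometry (Fin 3)) (hsDiameter σ N) (fun s => Φ.flow s z) ∩ Ioc 0 t).Finite :=
    Φ.finite_collisionTimes_inter hz Ioc_subset_Icc_self
  rw [HardSphereFlow.collisionSum_eq, collisionSum_eq_finset_sum hfin]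
  have htm : t ∈ hfin.toFinset :=
    (Set.Finite.mem_toFinset _).2 ⟨mem_collisionTimes_of_mem_contactPairs hp, ht, le_rfl⟩
  refine le_trans ?_ (Finset.single_le_sum
    (fun s _ => Finset.sum_nonneg fun q _ => ite_impulse_nonneg _ _) htm)
  refine le_trans (le_of_eq ?_) (Finset.single_le_sum (fun q _ => ite_impulse_nonneg _ _) hp)
  rw [ofConfig_fst, if_pos rfl]

/-- A record retained by the adapted clamp of its first particle has impulse at most `(τ/σ) V`. -/
theorem impulse_le_of_flagA (hz : z ∈ Φ.good) (hσ : 0 < σ) (hτ : 0 < τ) {t : ℝ} (ht : 0 < t)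
    {p : Fin (N + 1) × Fin (N + 1)} (hp : p ∈ contactPairs (Torus.geometry (Fin 3)) (hsDiameter σ N) (Φ.flow t z))
    (hA : flagA σ τ V Φ t p.1 z = 1) :
    impulse (ofConfig (Torus.geometry (Fin 3)) (hsDiameter σ N) (Φ.flow t z) t p.1 p.2) ≤ τ / σ * V := by
  have hle : runAct σ τ Φ t p.1 z ≤ V := by
    by_contra h
    simp [flagA, h] at hA
  have h := (le_runAct Φ hz (div_pos hσ hτ).le ht hp).trans hle
  calc impulse _ = τ / σ * (σ / τ *
      impulse (ofConfig (Torus.geometry (Fin 3)) (hsDiameter σ N) (Φ.flow t z) t p.1 p.2)) := by field_simp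
    _ ≤ τ / σ * V := mul_le_mul_of_nonneg_left h (by positivity)

/-- The `n`-th coin of a good orbit, `n < coinCount`, is a collision time in the window `(0, w]`. -/
theorem coinTime_mem (hz : z ∈ Φ.good) {n : ℕ} (hn : n < coinCount σ τ Φ z) :
    coinTime Φ z n ∈ collisionTimes (Torus.geometry (Fin 3)) (hsDiameter σ N) (orbit Φ z) ∩ Ioc 0 (window τ N) :=
  (nthTimeAfter_mem (fun a b => (Φ.isTrajectory z hz).locFinite a b) n hn).1

/-- On the torus the ordered contact pairs are symmetric at EVERY diameter (the minimal-image distance is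
symmetric; no regularity `ε < 1/2` is needed). -/
theorem swap_mem_contactPairs_torus {ε : ℝ} {x : Phase N} {p : Fin (N + 1) × Fin (N + 1)}
    (hp : p ∈ contactPairs (Torus.geometry (Fin 3)) ε x) : p.swap ∈ contactPairs (Torus.geometry (Fin 3)) ε x := by
  rw [mem_contactPairs, mem_contactSet] at hp ⊢
  refine ⟨hp.1.symm, hp.2.1, ?_⟩
  rw [Prod.fst_swap, Prod.snd_swap, Torus.norm_geometry_sepVec, Torus.euclidDist_comm,
    ← Torus.norm_geometry_sepVec]
  exact hp.2.2

/-- On a good orbit there are at most two ordered contact pairs at any time: at a collision of `(i, j)` they are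
`(i, j)` and `(j, i)` (binary collisions; symmetric minimal-image distance). -/
theorem card_contactPairs_le_two (hz : z ∈ Φ.good) (t : ℝ) :
    (contactPairs (Torus.geometry (Fin 3)) (hsDiameter σ N) (Φ.flow t z)).card ≤ 2 := by
  rcases (contactPairs (Torus.geometry (Fin 3)) (hsDiameter σ N) (Φ.flow t z)).eq_empty_or_nonempty with
    h | ⟨⟨i, j⟩, hp⟩
  · simp [h]
  · have hpair : contactPairs (Torus.geometry (Fin 3)) (hsDiameter σ N) (Φ.flow t z) = {(i, j), (j, i)} := by
      ext e
      rw [Finset.mem_insert, Finset.mem_singleton]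
      refine ⟨fun he => (Φ.isTrajectory z hz).eq_or_eq_of_mem_contactPairs (t := t) hp he, ?_⟩
      rintro (rfl | rfl)
      exacts [hp, swap_mem_contactPairs_torus hp]
    rw [hpair]
    exact Finset.card_le_two

/-- **Twin records.** On a good orbit the record `(j, i)` of a collision of `(i, j)` has the same transfer
impulse: both records read the same left limit, and pair momentum and energy are conserved. -/
theorem impulse_twin (hz : z ∈ Φ.good) {t : ℝ} {p : Fin (N + 1) × Fin (N + 1)}
    (hp : p ∈ contactPairs (Torus.geometry (Fin 3)) (hsDiameter σ N) (Φ.flow t z)) :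
    impulse (ofConfig (Torus.geometry (Fin 3)) (hsDiameter σ N) (Φ.flow t z) t p.2 p.1) =
      impulse (ofConfig (Torus.geometry (Fin 3)) (hsDiameter σ N) (Φ.flow t z) t p.1 p.2) := by
  obtain ⟨i, j⟩ := p
  have hγ := Φ.isTrajectory z hz
  have h1 := hγ.ofConfig_preVel_eq_leftLim (t := t) hp
  have h2 := hγ.ofConfig_preVel_eq_leftLim (t := t) (swap_mem_contactPairs_torus hp)
  have hm := ofConfig_preVel_fst_add_snd (Torus.geometry (Fin 3)) (hsDiameter σ N) (Φ.flow t z) t i j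
  have he := ofConfig_norm_sq_preVel (Torus.geometry (Fin 3)) (hsDiameter σ N) (Φ.flow t z) t i j
  rw [h1] at hm he
  simp only [ofConfig_postVel] at hm he
  simp only [impulse, ofConfig_postVel, h1, h2]
  have hv : (Φ.flow t z j).2 - (Function.leftLim (fun s => Φ.flow s z) t j).2 =
      -((Φ.flow t z i).2 - (Function.leftLim (fun s => Φ.flow s z) t i).2) := by
    rw [neg_sub, sub_eq_sub_iff_add_eq_add, add_comm, ← hm]
  have hE : ‖(Φ.flow t z j).2‖ ^ 2 - ‖(Function.leftLim (fun s => Φ.flow s z) t j).2‖ ^ 2 =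
      -(‖(Φ.flow t z i).2‖ ^ 2 - ‖(Function.leftLim (fun s => Φ.flow s z) t i).2‖ ^ 2) := by
    linarith
  rw [hv, hE, norm_neg, abs_neg]

end Orbit

end AdaptedClampKinematics

/-- **Registered sub-goal anchoring this file**: the `n`-th coin, `n < coinCount`, is a collision time in `(0, w]`. -/
theorem adaptedClampKinematics_coinTime_mem {σ τ : ℝ} {N : ℕ} (Φ : Flow σ N) {z : Phase N} (hz : z ∈ Φ.good) {n : ℕ}
    (hn : n < coinCount σ τ Φ z) :
    coinTime Φ z n ∈ collisionTimes (Torus.geometry (Fin 3)) (hsDiameter σ N) (orbit Φ z) ∩ Set.Ioc 0 (window τ N) :=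
  AdaptedClampKinematics.coinTime_mem Φ hz hn

end Summit.AtomisticToContinuum.HydrodynamicLimit.Theorems.ClampedTransferCoin

end
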